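import Summits.CriticalPhenomena.PercolationContinuityZ3.Theorems.PercNearOneGluingNoHeavyLowerTailMajorityGluingTypeTableScaledCasesW1
import Summits.CriticalPhenomena.PercolationContinuityZ3.Theorems.PercNearOneGluingNoHeavyLowerTailMajorityGluingTypeTableScaledCasesW2
import Summits.CriticalPhenomena.PercolationContinuityZ3.Theorems.PercNearOneGluingNoHeavyLowerTailMajorityGluingTypeTableScaledCasesW3
import Summits.CriticalPhenomena.PercolationContinuityZ3.Theorems.PercNearOneGluingNoHeavyLowerTailMajorityGluingTypeTableScaledCasesW4
import Summits.CriticalPhenomena.PercolationContinuityZ3.Theorems.PercNearOneGluingNoHeavyLowerTailMajorityGluingTypeTableWindow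
import HarnessLib

/-!
# THE KERNEL BOTTOM of the symmetric (4,3) programme and THE WEAK (4,3) CELL ON `(0, 13/256]` IN THE KERNEL
(lane prim-rate, constants-miner 1, gen 30; KERNEL-WINDOW.md §0 (5), §6; RIGOROUS-CERTIFICATION.md §4 (THEOREM BOTTOM-3); BENCH M1-BOTTOM-KERNEL)

Support file for the closed crux `NoHeavyLowerTail` (stmt-CriticalPhenomena-4575), majority-gluing line.  Template S (the `s₀`-scaled conic
programme of THEOREM BOTTOM-3 at `M_top = 2^{-240/32} = 0.0055243`, three richness bands per relay, four dominant relays = 324 cases,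
328 kernel-checked certificates) closes every case, so by the cover `bottom_of_cases`:

* **`bottom_scaled`** — for every law `x ≥ 0` on the 94 types with the symmetric hypotheses `SymLaw 240 M x` (the 22 `O`-free vdBHK rows,
  normalisation, hub-pair and relay-root van den Berg–Kahn rows, hub/relay ISO₃, ISO₄, hub ISO₄, ISO₅) and the 27 `O`-rows, at ANY hub
  weight `0 < M ≤ 2^{-240/32}`: **`E(x) ≤ M`** (`E = E f/δ₁ − 1` in the lane's normalisation) — THEOREM BOTTOM-3's conclusion as a kernel
  theorem on `(0, 0.0055243]`, replacing the hand-constant kernel bottom `bottom_rows` (take-over `3·10⁻¹³`);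
* **`weak43_cell`** — with the kernel window `window_13_256` (`[0.0055189, 13/256]`): for every such law at any hub weight
  `0 < M ≤ 13/256`, **`(1 − M)·E(x) ≤ M`**, i.e. `E f ≤ δ₁/(1 − M)` — the weak `(4,3)` cell of the abstract route on the whole range
  `(0, 13/256]`, kernel-checked end to end (CONVEX-BOOTSTRAP.md §5 / RIGOROUS-CERTIFICATION.md §4, formerly «one engine in exact
  arithmetic»), conditional exactly on its row hypotheses as the window is.

No definitions, no sorries.  [cite: VandenbergHaggstromKahn2005, Thm. 1.3 (p. 6)]
-/

namespace Summit.CriticalPhenomena.PercolationContinuityZ3.Theorems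

namespace HubOnly
namespace TypeTable

open DType

/-- **THE KERNEL BOTTOM.**  Every law with the symmetric hypotheses and the `O`-rows at a hub weight `0 < M ≤ 2^{-240/32}` has `E(x) ≤ M`. -/
theorem bottom_scaled {M : ℝ} {x : DType → ℝ} (L : SymLaw 240 M x) (O : ∀ φ ∈ linOrd, lin φ x ≤ 0) : E x ≤ M :=
  bottom_of_cases (fun w hw => by
    simp only [List.mem_cons, List.not_mem_nil, or_false] at hw
    rcases hw with rfl | rfl | rfl | rfl
    · exact holds_w1
    · exact holds_w2
    · exact holds_w3
    · exact holds_w4) L O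

/-- The kernel bottom reaches the kernel window: `windowBottom = 0.0055189 ≤ 2^{-240/32}`. -/
theorem windowBottom_le_Mtop240 : ((windowBottom : ℚ) : ℝ) ≤ (2 : ℝ) ^ (-((240 : ℕ) : ℝ) / 32) :=
  le_trans (Rat.cast_le.mpr (by decide +kernel)) (grid_point_ge 240)

/-- **THE WEAK (4,3) CELL ON `(0, 13/256]`, KERNEL FORM.**  For every law `x ≥ 0` on the 94 types with the symmetric hypotheses
(`SymLaw k M x` at its own grid index) and the 27 `O`-rows, at any hub weight `0 < M ≤ 13/256`: `(1 − M)·E(x) ≤ M`. -/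
theorem weak43_cell {k : ℕ} {M : ℝ} {x : DType → ℝ} (L : SymLaw k M x) (O : ∀ φ ∈ linOrd, lin φ x ≤ 0)
    (hM : M ≤ (((13 / 256 : ℚ)) : ℝ)) : (1 - M) * E x ≤ M := by
  by_cases hw : ((windowBottom : ℚ) : ℝ) ≤ M
  · exact window_13_256 L hw hM
  · push Not at hw
    have hMle : M ≤ (2 : ℝ) ^ (-((240 : ℕ) : ℝ) / 32) := hw.le.trans windowBottom_le_Mtop240
    have hE := bottom_scaled (L.of_le hMle) O
    have hM1 : M ≤ 1 := le_one_of_grid hMle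
    have hMpos := L.Mpos
    by_cases hE0 : 0 ≤ E x
    · nlinarith
    · push Not at hE0; nlinarith
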